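import Mathlib
import Summits.Ventures.PercRepro2.CoinChainReductionGen
import Summits.Ventures.PercRepro2.CoinChainHeadHyps
import Summits.Ventures.PercRepro2.CoinChainPivotalCov

/-!
# The chain functional when the PIVOTAL law centred at the `R`-means is nonpositive
(blind cell PercRepro2, night-2 g21; proofs/NIGHT2-DARC.md §61.7)

One FKG: `T(R, G) = T(R, R) − T(R, P)` with `P = R − G` the pivotal mass, and `T(R, R) ≥ 0`
(`law_fkg`).  So the cleared functional is nonnegative as soon as the pivotal law's centred product
at the `R`-means, `T(R, P) = ∑ P (Λ x − Λ₁)(Λ y − Λ₂)`, is `≤ 0` — in particular whenever the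
pivotal law has nonpositive covariance AND its two shifts from the `R`-means have opposite signs
(the anti-aligned residual of §61.6).  `gate_functional_nonneg_of_pivotalCentred`,
`chain_functional_nonneg_of_pivotalCentred`, `darc_of_chain_of_pivotalCentred`.
-/

namespace Summit.Ventures.PercRepro2.Coin

open Classical

section PivotalCentredAbstract

variable {V : Type*} [DecidableEq V] {R : Type*} [Field R] [LinearOrder R] [IsStrictOrderedRing R]

/-- **THE GATE FUNCTIONAL WHEN THE PIVOTAL LAW CENTRED AT THE `R`-MEANS IS NONPOSITIVE.** -/
theorem gate_functional_nonneg_of_pivotalCentred (U : Finset V) (G G' x y : Finset V → R)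
    (hG : ∀ W, 0 ≤ G W) (hx0 : ∀ W, 0 ≤ x W) (hy0 : ∀ W, 0 ≤ y W)
    (hxm : ∀ s t, x s ≤ x (s ∪ t)) (hym : ∀ s t, y s ≤ y (s ∪ t))
    (wLL : ∀ s ⊆ U, ∀ t ⊆ U, G s * G t ≤ G (s ∩ t) * G (s ∪ t))
    (hP : (∑ W ∈ U.powerset, G W) ^ 2 * (∑ W ∈ U.powerset, (G W - G' W) * (x W * y W))
        - (∑ W ∈ U.powerset, G W) * (∑ W ∈ U.powerset, G W * x W) *
          (∑ W ∈ U.powerset, (G W - G' W) * y W)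
        - (∑ W ∈ U.powerset, G W) * (∑ W ∈ U.powerset, G W * y W) *
          (∑ W ∈ U.powerset, (G W - G' W) * x W)
        + (∑ W ∈ U.powerset, G W * x W) * (∑ W ∈ U.powerset, G W * y W) *
          (∑ W ∈ U.powerset, (G W - G' W)) ≤ 0) :
    0 ≤ (∑ W ∈ U.powerset, G W) ^ 2 * (∑ W ∈ U.powerset, G' W * (x W * y W))
        - (∑ W ∈ U.powerset, G W) * (∑ W ∈ U.powerset, G W * x W) *
          (∑ W ∈ U.powerset, G' W * y W)
        - (∑ W ∈ U.powerset, G W) * (∑ W ∈ U.powerset, G W * y W) *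
          (∑ W ∈ U.powerset, G' W * x W)
        + (∑ W ∈ U.powerset, G W * x W) * (∑ W ∈ U.powerset, G W * y W) *
          (∑ W ∈ U.powerset, G' W) := by
  have hR := law_fkg U G x y hG hx0 hy0 hxm hym wLL
  have e0 : (∑ W ∈ U.powerset, G' W) = (∑ W ∈ U.powerset, G W) - ∑ W ∈ U.powerset, (G W - G' W) := by
    rw [← Finset.sum_sub_distrib]; exact Finset.sum_congr rfl fun W _ => by ring
  have ex : (∑ W ∈ U.powerset, G' W * x W) =
      (∑ W ∈ U.powerset, G W * x W) - ∑ W ∈ U.powerset, (G W - G' W) * x W := by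
    rw [← Finset.sum_sub_distrib]; exact Finset.sum_congr rfl fun W _ => by ring
  have ey : (∑ W ∈ U.powerset, G' W * y W) =
      (∑ W ∈ U.powerset, G W * y W) - ∑ W ∈ U.powerset, (G W - G' W) * y W := by
    rw [← Finset.sum_sub_distrib]; exact Finset.sum_congr rfl fun W _ => by ring
  have exy : (∑ W ∈ U.powerset, G' W * (x W * y W)) =
      (∑ W ∈ U.powerset, G W * (x W * y W)) - ∑ W ∈ U.powerset, (G W - G' W) * (x W * y W) := by
    rw [← Finset.sum_sub_distrib]; exact Finset.sum_congr rfl fun W _ => by ring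
  have hΛ0 : 0 ≤ ∑ W ∈ U.powerset, G W := Finset.sum_nonneg fun W _ => hG W
  rw [e0, ex, ey, exy]
  generalize (∑ W ∈ U.powerset, G W) = Λ at hR hP hΛ0 ⊢
  generalize (∑ W ∈ U.powerset, G W * x W) = Λ₁ at hR hP ⊢
  generalize (∑ W ∈ U.powerset, G W * y W) = Λ₂ at hR hP ⊢
  generalize (∑ W ∈ U.powerset, G W * (x W * y W)) = Λ₁₂ at hR ⊢
  generalize (∑ W ∈ U.powerset, (G W - G' W)) = P₀ at hP ⊢
  generalize (∑ W ∈ U.powerset, (G W - G' W) * x W) = Px at hP ⊢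
  generalize (∑ W ∈ U.powerset, (G W - G' W) * y W) = Py at hP ⊢
  generalize (∑ W ∈ U.powerset, (G W - G' W) * (x W * y W)) = Pxy at hP ⊢
  have hTRR : 0 ≤ Λ * (Λ * Λ₁₂ - Λ₁ * Λ₂) := mul_nonneg hΛ0 (by linarith [hR])
  nlinarith [hTRR, hP]

end PivotalCentredAbstract

section PivotalCentredChain

variable {V : Type*} [DecidableEq V] {R : Type*} [Field R] [LinearOrder R] [IsStrictOrderedRing R]

/-- **THE AND-SWITCH CHAIN WHEN THE PIVOTAL LAW CENTRED AT THE CHAIN `R`-MEANS IS NONPOSITIVE.** -/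
theorem chain_functional_nonneg_of_pivotalCentred (U ent ent' : Finset V) (ν c d d' : Finset V → R)
    (ρ : R) (hρ0 : 0 ≤ ρ) (hρ1 : ρ ≤ 1) (hν0 : ∀ W, 0 ≤ ν W)
    (hν : ∀ s ⊆ U, ∀ t ⊆ U, ν s * ν t ≤ ν (s ∩ t) * ν (s ∪ t))
    (hc0 : ∀ W, 0 ≤ c W) (hd0 : ∀ W, 0 ≤ d W) (hdc : ∀ W, d W ≤ c W)
    (hcc : ∀ s t, c s * c t ≤ c (s ∩ t) * c (s ∪ t))
    (hdd : ∀ s t, d s * d t ≤ d (s ∩ t) * d (s ∪ t))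
    (hcd : ∀ s t, c s * d t ≤ c (s ∩ t) * d (s ∪ t))
    (hratio : ∀ s t, s ⊆ t → d s * c t ≤ c s * d t)
    (x y : Finset V → R) (hx0 : ∀ W, 0 ≤ x W) (hy0 : ∀ W, 0 ≤ y W)
    (hxm : ∀ s t, x s ≤ x (s ∪ t)) (hym : ∀ s t, y s ≤ y (s ∪ t))
    (hP : (∑ W ∈ U.powerset, ν W * chainMix ent ent' ρ c d W) ^ 2 *
          (∑ W ∈ U.powerset, ν W * (chainMix ent ent' ρ c d W - chainMix ent ent' ρ c d' W) *
            (x W * y W))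
        - (∑ W ∈ U.powerset, ν W * chainMix ent ent' ρ c d W) *
          (∑ W ∈ U.powerset, ν W * chainMix ent ent' ρ c d W * x W) *
          (∑ W ∈ U.powerset, ν W * (chainMix ent ent' ρ c d W - chainMix ent ent' ρ c d' W) * y W)
        - (∑ W ∈ U.powerset, ν W * chainMix ent ent' ρ c d W) *
          (∑ W ∈ U.powerset, ν W * chainMix ent ent' ρ c d W * y W) *
          (∑ W ∈ U.powerset, ν W * (chainMix ent ent' ρ c d W - chainMix ent ent' ρ c d' W) * x W)
        + (∑ W ∈ U.powerset, ν W * chainMix ent ent' ρ c d W * x W) *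
          (∑ W ∈ U.powerset, ν W * chainMix ent ent' ρ c d W * y W) *
          (∑ W ∈ U.powerset, ν W * (chainMix ent ent' ρ c d W - chainMix ent ent' ρ c d' W)) ≤ 0) :
    0 ≤ (∑ W ∈ U.powerset, ν W * chainMix ent ent' ρ c d W) ^ 2 *
          (∑ W ∈ U.powerset, ν W * chainMix ent ent' ρ c d' W * (x W * y W))
        - (∑ W ∈ U.powerset, ν W * chainMix ent ent' ρ c d W) *
          (∑ W ∈ U.powerset, ν W * chainMix ent ent' ρ c d W * x W) *
          (∑ W ∈ U.powerset, ν W * chainMix ent ent' ρ c d' W * y W)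
        - (∑ W ∈ U.powerset, ν W * chainMix ent ent' ρ c d W) *
          (∑ W ∈ U.powerset, ν W * chainMix ent ent' ρ c d W * y W) *
          (∑ W ∈ U.powerset, ν W * chainMix ent ent' ρ c d' W * x W)
        + (∑ W ∈ U.powerset, ν W * chainMix ent ent' ρ c d W * x W) *
          (∑ W ∈ U.powerset, ν W * chainMix ent ent' ρ c d W * y W) *
          (∑ W ∈ U.powerset, ν W * chainMix ent ent' ρ c d' W) := by
  set G : Finset V → R := fun W => ν W * chainMix ent ent' ρ c d W with hGdef
  set G' : Finset V → R := fun W => ν W * chainMix ent ent' ρ c d' W with hG'def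
  have hm0 : ∀ W, 0 ≤ chainMix ent ent' ρ c d W := chainMix_nonneg ent ent' hρ0 hρ1 hc0 hd0
  have hG0 : ∀ W, 0 ≤ G W := fun W => mul_nonneg (hν0 W) (hm0 W)
  have hmix := mixture_lsm ent ent' ρ hρ0 hρ1 c d hc0 hd0 hdc hcc hdd hcd hratio
  have wLL : ∀ s ⊆ U, ∀ t ⊆ U, G s * G t ≤ G (s ∩ t) * G (s ∪ t) := by
    intro s hs t ht
    simp only [hGdef]
    calc ν s * chainMix ent ent' ρ c d s * (ν t * chainMix ent ent' ρ c d t)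
        = (ν s * ν t) * (chainMix ent ent' ρ c d s * chainMix ent ent' ρ c d t) := by ring
      _ ≤ (ν (s ∩ t) * ν (s ∪ t)) *
            (chainMix ent ent' ρ c d (s ∩ t) * chainMix ent ent' ρ c d (s ∪ t)) :=
          mul_le_mul (hν s hs t ht) (hmix s t) (mul_nonneg (hm0 _) (hm0 _))
            (mul_nonneg (hν0 _) (hν0 _))
      _ = _ := by ring
  have hPdiff : ∀ W, G W - G' W = ν W * (chainMix ent ent' ρ c d W - chainMix ent ent' ρ c d' W) :=
    fun W => by simp only [hGdef, hG'def]; ring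
  have hP' := hP
  simp only [← hPdiff] at hP'
  exact gate_functional_nonneg_of_pivotalCentred U G G' x y hG0 hx0 hy0 hxm hym wLL hP'

end PivotalCentredChain

section PivotalCentredDarc

variable {V : Type*} {E : Type*} [Fintype V] [DecidableEq V] [Fintype E] [DecidableEq E]
  {R : Type*} [Field R] [LinearOrder R] [IsStrictOrderedRing R]
  {arcs : E → Finset (V × V)} {s : V} {U : Finset V} {ent ent' : Finset V} {c' : V → E}
  {a' a w : V} {c : V → E}

/-- **ROW 2′DARC AT THE GENERAL CHAIN WHEN THE PIVOTAL LAW CENTRED AT THE CHAIN `R`-MEANS IS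
NONPOSITIVE** — the cleared `∑ P (Λ x − Λ₁)(Λ y − Λ₂) ≤ 0` for the pivotal mass
`ν · (chainMix ρ chainC chainD − chainMix ρ chainC chainD')` and the point markers. -/
theorem darc_of_chain_of_pivotalCentred (pr : E → R) (hp : IsProbVec pr) (hS : SameEnds arcs)
    (h' : OrTailK arcs s U ent' c' a') (hsure' : ∀ r ∈ ent', pr (c' r) = 1)
    (h : OrTailK arcs s (insert a' U) (insert a' ent) c a) (hsure : ∀ r ∈ ent, pr (c r) = 1)
    (hentU : ent ⊆ U)
    {m₁ m₂ : V} (hm₁ : m₁ ∈ U) (hm₂ : m₂ ∈ U)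
    (hν : ∀ W W', W ⊆ U → W' ⊆ U →
      prob pr (coreLevel arcs s U W) * prob pr (coreLevel arcs s U W') ≤
        prob pr (coreLevel arcs s U (W ∩ W')) * prob pr (coreLevel arcs s U (W ∪ W')))
    {t : V} (htC : t ∉ insert a (insert a' U)) (hts : t ≠ s) (hws : w ≠ s)
    (hwC : w ∉ insert a (insert a' U))
    (hP : (∑ W ∈ U.powerset, prob pr (coreLevel arcs s U W) *
            chainMix ent ent' (pr (c a')) (chainC pr arcs s t U ent' a' a) (chainD pr arcs s t U ent' a' a) W) ^ 2 *
          (∑ W ∈ U.powerset, prob pr (coreLevel arcs s U W) *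
            (chainMix ent ent' (pr (c a')) (chainC pr arcs s t U ent' a' a) (chainD pr arcs s t U ent' a' a) W -
             chainMix ent ent' (pr (c a')) (chainC pr arcs s t U ent' a' a) (chainD' pr arcs s t U ent' a' a w) W) *
            ((if m₁ ∈ W then (1 : R) else 0) * (if m₂ ∈ W then (1 : R) else 0)))
        - (∑ W ∈ U.powerset, prob pr (coreLevel arcs s U W) *
            chainMix ent ent' (pr (c a')) (chainC pr arcs s t U ent' a' a) (chainD pr arcs s t U ent' a' a) W) *
          (∑ W ∈ U.powerset, prob pr (coreLevel arcs s U W) *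
            chainMix ent ent' (pr (c a')) (chainC pr arcs s t U ent' a' a) (chainD pr arcs s t U ent' a' a) W *
            (if m₁ ∈ W then (1 : R) else 0)) *
          (∑ W ∈ U.powerset, prob pr (coreLevel arcs s U W) *
            (chainMix ent ent' (pr (c a')) (chainC pr arcs s t U ent' a' a) (chainD pr arcs s t U ent' a' a) W -
             chainMix ent ent' (pr (c a')) (chainC pr arcs s t U ent' a' a) (chainD' pr arcs s t U ent' a' a w) W) *
            (if m₂ ∈ W then (1 : R) else 0))
        - (∑ W ∈ U.powerset, prob pr (coreLevel arcs s U W) *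
            chainMix ent ent' (pr (c a')) (chainC pr arcs s t U ent' a' a) (chainD pr arcs s t U ent' a' a) W) *
          (∑ W ∈ U.powerset, prob pr (coreLevel arcs s U W) *
            chainMix ent ent' (pr (c a')) (chainC pr arcs s t U ent' a' a) (chainD pr arcs s t U ent' a' a) W *
            (if m₂ ∈ W then (1 : R) else 0)) *
          (∑ W ∈ U.powerset, prob pr (coreLevel arcs s U W) *
            (chainMix ent ent' (pr (c a')) (chainC pr arcs s t U ent' a' a) (chainD pr arcs s t U ent' a' a) W -
             chainMix ent ent' (pr (c a')) (chainC pr arcs s t U ent' a' a) (chainD' pr arcs s t U ent' a' a w) W) *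
            (if m₁ ∈ W then (1 : R) else 0))
        + (∑ W ∈ U.powerset, prob pr (coreLevel arcs s U W) *
            chainMix ent ent' (pr (c a')) (chainC pr arcs s t U ent' a' a) (chainD pr arcs s t U ent' a' a) W *
            (if m₁ ∈ W then (1 : R) else 0)) *
          (∑ W ∈ U.powerset, prob pr (coreLevel arcs s U W) *
            chainMix ent ent' (pr (c a')) (chainC pr arcs s t U ent' a' a) (chainD pr arcs s t U ent' a' a) W *
            (if m₂ ∈ W then (1 : R) else 0)) *
          (∑ W ∈ U.powerset, prob pr (coreLevel arcs s U W) *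
            (chainMix ent ent' (pr (c a')) (chainC pr arcs s t U ent' a' a) (chainD pr arcs s t U ent' a' a) W -
             chainMix ent ent' (pr (c a')) (chainC pr arcs s t U ent' a' a) (chainD' pr arcs s t U ent' a' a w) W)) ≤ 0) :
    DARC pr arcs s {t} m₁ m₂ a w := by
  obtain ⟨hA0, hAmono, hAlsm⟩ := OrTailU.head_props (U := insert a' U) (a := a) pr hp hS t
  obtain ⟨hdc, -, hcc, hdd, -, -, hratio, -, -, hcd, -⟩ :=
    chainPhi_head_hyps (fun X => prob pr (coreAvoidEvent arcs s t (insert a (insert a' U)) X))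
      ent' a' a w hA0 hAmono hAlsm
  have hx0 : ∀ W : Finset V, (0 : R) ≤ (if m₁ ∈ W then (1 : R) else 0) := by
    intro W; split_ifs <;> norm_num
  have hy0 : ∀ W : Finset V, (0 : R) ≤ (if m₂ ∈ W then (1 : R) else 0) := by
    intro W; split_ifs <;> norm_num
  have hxm : ∀ s t : Finset V,
      (if m₁ ∈ s then (1 : R) else 0) ≤ (if m₁ ∈ s ∪ t then (1 : R) else 0) := by
    intro s t
    by_cases h : m₁ ∈ s
    · rw [if_pos h, if_pos (Finset.mem_union_left t h)]
    · rw [if_neg h]; split_ifs <;> norm_num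
  have hym : ∀ s t : Finset V,
      (if m₂ ∈ s then (1 : R) else 0) ≤ (if m₂ ∈ s ∪ t then (1 : R) else 0) := by
    intro s t
    by_cases h : m₂ ∈ s
    · rw [if_pos h, if_pos (Finset.mem_union_left t h)]
    · rw [if_neg h]; split_ifs <;> norm_num
  refine chain_darc_of_functional pr hS h' hsure' h hsure hentU hm₁ hm₂ htC hts hws hwC ?_
  exact chain_functional_nonneg_of_pivotalCentred U ent ent' (fun W => prob pr (coreLevel arcs s U W))
    (chainC pr arcs s t U ent' a' a) (chainD pr arcs s t U ent' a' a) (chainD' pr arcs s t U ent' a' a w)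
    (pr (c a')) (hp.nonneg _) (hp.le_one _) (fun W => prob_nonneg hp _)
    (fun s' hs' t' ht' => hν s' t' hs' ht') (fun W => hA0 _) (fun W => hA0 _)
    hdc hcc hdd hcd hratio
    (fun W => if m₁ ∈ W then (1 : R) else 0) (fun W => if m₂ ∈ W then (1 : R) else 0)
    hx0 hy0 hxm hym hP

end PivotalCentredDarc

end Summit.Ventures.PercRepro2.Coin
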